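import Summits.BirchSwinnertonDyer.BirchSwinnertonDyer.Theorems.CyclotomicUntwistDescendedFrobeniusTransferSemantics
import Summits.BirchSwinnertonDyer.BirchSwinnertonDyer.Theorems.CyclotomicUntwistDescendedFrobeniusTransferBasis
import Summits.BirchSwinnertonDyer.BirchSwinnertonDyer.Theorems.CyclotomicUntwistNineIntegersStructure
import HarnessLib

/-!
# Route `CyclotomicUntwist`: Katz's Key Lemma MODULO THE UNIFORMIZER `ϖ = 1 − ζ₉` of `𝓞 = 𝓞_{ℚ₃(ζ₉)}` for the
# module with BOUNDED DENOMINATORS, and the Frobenius `φ : [f] ↦ [f(z³)]` on the second-kind classes of a good model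

Cell `pub/bsd-wall` (D-0145 line `route-BirchSwinnertonDyer-CyclotomicUntwist`), prover seat `bsd-line-cycu-p3`
(gen 8), lane «KATZ FROBENIUS MOD ϖ» (STATUS 2026-08-28T11:58:44Z). THEOREMS ONLY (no definition, no named fact, no
`sorry`); helper `--supports` K1 = stmt-BirchSwinnertonDyer-21580 (serves K2 = 21581 and the print child C2 =
stmt-BirchSwinnertonDyer-27549 / 27616 `PSDescendedFrobeniusPrintedInputsAtThree`, whose exact cost is the Literature
named fact `WeierstrassCurve.isDescendedFrobeniusMatrix_exists`). BSD is not proved by this file and no crux is.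
Currency: `KNine = ℚ₃(ζ₉)`, `ONine = integralClosure ℤ₃ KNine`, `HasBoundedDenominators` of
`Literature.DescendedFrobeniusMatrix` (p623342); sequel of cycu-p2's `…DescendedFrobeniusTransferSemantics` (Key Lemma
modulo the divided-power ideal `(3)`).

## The observation

Katz's Key Lemma [Ka81, 5.1.3] (`f(U) − f(V)` INTEGRAL when `U ≡ V` modulo an ideal with divided powers and `df`
integral) needs divided powers only for integrality. The Literature predicate works in `D(Ê/𝓞) ⊗ ℚ`, i.e. modulo
series with BOUNDED denominators, and there the hypothesis can be weakened to `U ≡ V (mod ϖ)` for the uniformizer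
`ϖ = 1 − ζ₉` (ramification index `6 > p − 1`, so `(ϖ)` has NO divided powers): with `3 = ϖ⁶·θ`, `θ ∈ 𝓞ˣ`,
one has `ϖ^{6k+3} ∣ U^{3^{k+1}} − V^{3^{k+1}}` (§1), hence `m ∣ 3·(Uᵐ − Vᵐ)` for every `m`, and
**`3·(f(U) − f(V))` has `𝓞`-integral coefficients whenever `n·[zⁿ]f ∈ 𝓞`** (§2; the estimate
`sup_j ‖ϖʲ/j‖ = ‖ϖ⁻³‖ < ∞`). Consequences for a Weierstrass equation `E/𝓞` with formal group law `Ĝ` (§4):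
`Ĝ(X,Y)³ ≡ Ĝ(X³,Y³) (mod ϖ)` (the residue field of `𝓞` is `𝔽₃`, cycu-p4's `NineIntegers.residueMap_eq_zero_iff`), so
**`φ[f] := [f(z³)]` is a well-defined endomorphism of the module of second-kind classes
`{f : f(0) = 0, n·fₙ bounded, ∂_Ĝ f bounded}/bounded`** (`coboundary_expand_three`) — directly over the ramified base,
with `φ² = (z ↦ z⁹)^*`, `φ³ = (z ↦ z²⁷)^*` the power maps of the Literature predicate `IsPowerMapMatrix`. No `ℤ₃`-lift,
no Berthelot–Ogus transfer and no Honda theory enter.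

* §1 `pow_dvd_pow_three_pow_succ_sub`, `natCast_dvd_three_mul_pow_sub_pow` (any commutative ring with `3 = ϖ⁶θ`,
  `θθ' = 1`, integers prime to `3` invertible);
* §2 `isIntegral_three_pow_mul_mvCoeff_subst_sub_subst` — the Key Lemma modulo `ϖ` over `𝓞`, for `f ∈ ℚ₃(ζ₉)⟦z⟧` with
  `3ᵈ·n·[zⁿ]f ∈ 𝓞`;
* §3 `exists_uniformizer` — `ϖ = 1 − ζ₉`, `θ`, `θ'` and the kernel of the reduction map (cycu-p4 g7 / cycu-p3 g7);
* §4 `dvd_mvCoeff_pow_three_sub_expand` (`Ĝ³ ≡ Ĝ(X³,Y³) (mod ϖ)`), `isIntegral_natCast_mul_coeff_expand`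
  (`n·[zⁿ]f(z³)` stays bounded), **`coboundary_expand_three`** (`∂_Ĝ(f(z³))` bounded if `∂_Ĝ f` is).
[cite: Katz1981CrystallineDieudonne, §5 Key Lemma 5.1.3 and Thm 5.1.4] [cite: BerthelotOgus1983, Thm. 2.4 (proof)]
-/

set_option autoImplicit false
-- single-conjunct summit: `Summit.BirchSwinnertonDyer.BirchSwinnertonDyer.…` repeats the name by design
set_option linter.dupNamespace false

noncomputable section

open PowerSeries Literature.NumberTheory.EllipticCurves.DescendedFrobenius
  Summit.BirchSwinnertonDyer.BirchSwinnertonDyer.Theorems.DescendedFrobeniusTransfer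

namespace Summit.BirchSwinnertonDyer.BirchSwinnertonDyer.Theorems.KatzFrobenius

/-! ## §1 `ϖ^{6k+3} ∣ U^{3^{k+1}} − V^{3^{k+1}}` and `m ∣ 3·(Uᵐ − Vᵐ)` when `3 = ϖ⁶θ` -/

section Ring

variable {R : Type*} [CommRing R] {ϖ θ θ' u v : R}

/-- `u³ − v³ = (u − v)³ + 3uv(u − v)`. [folklore] -/
theorem pow_three_sub_pow_three (u v : R) : u ^ 3 - v ^ 3 = (u - v) ^ 3 + 3 * u * v * (u - v) := by ring

/-- `ϖ ∣ u − v` and `3 = ϖ⁶θ` ⟹ `ϖ³ ∣ u³ − v³`. [cite: Katz1981CrystallineDieudonne, §5 Key Lemma 5.1.3] -/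
theorem pow_three_dvd_pow_three_sub (h3 : (3 : R) = ϖ ^ 6 * θ) (h : ϖ ∣ u - v) : ϖ ^ 3 ∣ u ^ 3 - v ^ 3 := by
  obtain ⟨c, hc⟩ := h
  rw [pow_three_sub_pow_three, hc, h3]
  exact ⟨c ^ 3 + ϖ ^ 4 * θ * u * v * c, by ring⟩

/-- `ϖʲ ∣ u − v` with `j ≥ 3` and `3 = ϖ⁶θ` ⟹ `ϖ^{j+6} ∣ u³ − v³`. [cite: Katz1981CrystallineDieudonne, §5 Key Lemma 5.1.3] -/
theorem pow_add_six_dvd_pow_three_sub (h3 : (3 : R) = ϖ ^ 6 * θ) {j : ℕ} (hj : 3 ≤ j) (h : ϖ ^ j ∣ u - v) :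
    ϖ ^ (j + 6) ∣ u ^ 3 - v ^ 3 := by
  obtain ⟨c, hc⟩ := h
  obtain ⟨i, rfl⟩ := Nat.exists_eq_add_of_le hj
  rw [pow_three_sub_pow_three, hc, h3]
  refine ⟨ϖ ^ (2 * i) * c ^ 3 + θ * u * v * c, ?_⟩
  ring

/-- **`ϖ^{6k+3} ∣ u^{3^{k+1}} − v^{3^{k+1}}`** when `ϖ ∣ u − v` and `3 = ϖ⁶θ` (induction: `3, 9, 15, 21, …`).
[cite: Katz1981CrystallineDieudonne, §5 Key Lemma 5.1.3] -/
theorem pow_dvd_pow_three_pow_succ_sub (h3 : (3 : R) = ϖ ^ 6 * θ) (h : ϖ ∣ u - v) (k : ℕ) :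
    ϖ ^ (6 * k + 3) ∣ u ^ 3 ^ (k + 1) - v ^ 3 ^ (k + 1) := by
  induction k with
  | zero => simpa using pow_three_dvd_pow_three_sub h3 h
  | succ k ih =>
    have e : ∀ w : R, w ^ 3 ^ (k + 1 + 1) = (w ^ 3 ^ (k + 1)) ^ 3 := fun w ↦ by rw [← pow_mul, ← pow_succ]
    rw [e, e, show 6 * (k + 1) + 3 = (6 * k + 3) + 6 by ring]
    exact pow_add_six_dvd_pow_three_sub h3 (by omega) ih

/-- **`m ∣ 3·(uᵐ − vᵐ)`** for every `m`, when `ϖ ∣ u − v`, `3 = ϖ⁶θ` with `θθ' = 1`, and every natural number prime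
to `3` is a unit of `R` (write `m = 3ᵏr`: `3ᵏ = ϖ^{6k}θᵏ` divides `3·ϖ^{6k−3}`). This is the bounded-denominator
substitute for Katz's `m·3 ∣ uᵐ − vᵐ` modulo a divided-power ideal. [cite: Katz1981CrystallineDieudonne, §5 Key Lemma 5.1.3] -/
theorem natCast_dvd_three_mul_pow_sub_pow (h3 : (3 : R) = ϖ ^ 6 * θ) (hθ : θ * θ' = 1)
    (hunit : ∀ r : ℕ, ¬ 3 ∣ r → IsUnit (r : R)) (h : ϖ ∣ u - v) (m : ℕ) :
    (m : R) ∣ 3 * (u ^ m - v ^ m) := by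
  rcases eq_or_ne m 0 with rfl | hm
  · simp
  obtain ⟨k, r, hr, rfl⟩ := Nat.exists_eq_pow_mul_and_not_dvd hm 3 (by norm_num)
  rw [Nat.cast_mul, Nat.cast_pow, Nat.cast_ofNat]
  refine (hunit r hr).mul_right_dvd.mpr ?_
  rcases k with _ | k
  · simp
  -- `u^{3^{k+1}} − v^{3^{k+1}} ∣ uᵐ − vᵐ`
  have h1 : u ^ 3 ^ (k + 1) - v ^ 3 ^ (k + 1) ∣ u ^ (3 ^ (k + 1) * r) - v ^ (3 ^ (k + 1) * r) := by
    rw [pow_mul, pow_mul]; exact sub_dvd_pow_sub_pow _ _ r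
  obtain ⟨D, hD⟩ := (pow_dvd_pow_three_pow_succ_sub h3 h k).trans h1
  rw [hD, h3]
  have hθk : θ ^ (k + 1) * θ' ^ k = θ := by
    rw [pow_succ', mul_assoc, ← mul_pow, hθ, one_pow, mul_one]
  exact ⟨ϖ ^ 3 * θ' ^ k * D, by linear_combination (-(ϖ ^ (6 * k + 9) * D)) * hθk⟩

end Ring

/-! ## §2 Katz's Key Lemma modulo `ϖ` over `𝓞 = 𝓞_{ℚ₃(ζ₉)}`, bounded-denominator form -/

/-- Integers prime to `3` are units of `𝓞`. [folklore] -/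
theorem isUnit_natCast_ONine {r : ℕ} (hr : ¬ 3 ∣ r) : IsUnit (r : ONine) := by
  have h : IsUnit (r : ℤ_[3]) := by
    rw [PadicInt.isUnit_iff, PadicInt.norm_natCast_eq_one_iff]
    exact (Nat.Prime.coprime_iff_not_dvd Nat.prime_three).mpr hr
  simpa using h.map (algebraMap ℤ_[3] ONine)

/-- **Katz's Key Lemma 5.1.3 MODULO `ϖ`, for bounded denominators.** Let `3 = ϖ⁶θ` in `𝓞` with `θ` a unit, let
`f ∈ ℚ₃(ζ₉)⟦z⟧` satisfy `3ᵈ·n·[zⁿ]f ∈ 𝓞` for all `n` (`df` has bounded denominators), and let `U, V ∈ 𝓞⟦σ⟧` have no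
constant term and satisfy `U ≡ V (mod ϖ𝓞⟦σ⟧)`. Then `3^{d+1}·(f(U) − f(V))` has `𝓞`-integral coefficients:
`f(U) − f(V) = Σₘ fₘ(Uᵐ − Vᵐ)` and `m ∣ 3(Uᵐ − Vᵐ)` (§1) absorbs the denominator of `fₘ`.
[cite: Katz1981CrystallineDieudonne, §5 Key Lemma 5.1.3] -/
theorem isIntegral_three_pow_mul_mvCoeff_subst_sub_subst {σ : Type*} {ϖ θ θ' : ONine}
    (h3 : (3 : ONine) = ϖ ^ 6 * θ) (hθ : θ * θ' = 1) {f : KNine⟦X⟧} {d : ℕ}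
    (hf : ∀ n : ℕ, IsIntegral ℤ_[3] ((3 : KNine) ^ d * ((n : KNine) * coeff n f)))
    {U V : MvPowerSeries σ ONine} (hU0 : MvPowerSeries.constantCoeff U = 0) (hV0 : MvPowerSeries.constantCoeff V = 0)
    (hUV : MvPowerSeries.C ϖ ∣ U - V) (e : σ →₀ ℕ) :
    IsIntegral ℤ_[3] ((3 : KNine) ^ (d + 1) * MvPowerSeries.coeff e
      (f.subst (U.map (algebraMap ONine KNine)) - f.subst (V.map (algebraMap ONine KNine)))) := by
  have hU0' : MvPowerSeries.constantCoeff (U.map (algebraMap ONine KNine)) = 0 := by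
    rw [MvPowerSeries.constantCoeff_map, hU0, map_zero]
  have hV0' : MvPowerSeries.constantCoeff (V.map (algebraMap ONine KNine)) = 0 := by
    rw [MvPowerSeries.constantCoeff_map, hV0, map_zero]
  -- `3 = C ϖ ^ 6 * C θ` in `𝓞⟦σ⟧`
  have h3' : (3 : MvPowerSeries σ ONine) = MvPowerSeries.C ϖ ^ 6 * MvPowerSeries.C θ := by
    rw [← map_pow, ← map_mul, ← h3, map_ofNat]
  have hθC : MvPowerSeries.C θ * MvPowerSeries.C θ' = (1 : MvPowerSeries σ ONine) := by
    rw [← map_mul, hθ, map_one]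
  rw [map_sub, mvCoeff_subst_eq_sum_ring hU0', mvCoeff_subst_eq_sum_ring hV0', ← Finset.sum_sub_distrib,
    Finset.mul_sum]
  refine IsIntegral.sum _ fun m _ ↦ ?_
  rw [← mul_sub, ← map_pow, ← map_pow, MvPowerSeries.coeff_map, MvPowerSeries.coeff_map, ← map_sub, ← map_sub]
  obtain ⟨w, hw⟩ := natCast_dvd_three_mul_pow_sub_pow (R := MvPowerSeries σ ONine) h3' hθC
    (fun _ hr => isUnit_natCast_mvPowerSeries_ONine hr) hUV m
  -- `3^{d+1} f_m c(Uᵐ − Vᵐ) = (3^d m f_m) · c(w)`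
  have hc : (3 : KNine) * algebraMap ONine KNine (MvPowerSeries.coeff e (U ^ m - V ^ m)) =
      (m : KNine) * algebraMap ONine KNine (MvPowerSeries.coeff e w) := by
    have := congrArg (fun G ↦ algebraMap ONine KNine (MvPowerSeries.coeff e G)) hw
    rw [show (3 : MvPowerSeries σ ONine) = MvPowerSeries.C (3 : ONine) from (map_ofNat _ 3).symm,
      show ((m : ℕ) : MvPowerSeries σ ONine) = MvPowerSeries.C (m : ONine) from (map_natCast _ m).symm,
      MvPowerSeries.coeff_C_mul, MvPowerSeries.coeff_C_mul, map_mul, map_mul, map_natCast] at this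
    rw [← this, map_ofNat]
  have e1 : (3 : KNine) ^ (d + 1) * (coeff m f * algebraMap ONine KNine (MvPowerSeries.coeff e (U ^ m - V ^ m))) =
      ((3 : KNine) ^ d * ((m : KNine) * coeff m f)) * algebraMap ONine KNine (MvPowerSeries.coeff e w) := by
    rw [pow_succ, mul_assoc, ← mul_assoc (3 : KNine), mul_comm (3 : KNine) (coeff m f), mul_assoc (coeff m f), hc]
    ring
  rw [e1]
  exact (hf m).mul (MvPowerSeries.coeff e w).2

/-! ## §3 The uniformizer `ϖ = 1 − ζ₉`: `3 = ϖ⁶θ`, `θ ∈ 𝓞ˣ`, `ker(𝓞 → 𝔽₃) = (ϖ)`, `x³ ≡ x (mod ϖ)` -/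

section Uniformizer

open IsCyclotomicExtension Summit.BirchSwinnertonDyer.BirchSwinnertonDyer.Theorems.NineIntegers

/-- **The uniformizer of `𝓞 = 𝓞_{ℚ₃(ζ₉)}`, packaged**: there are `ϖ (= 1 − ζ₉), θ, θ' ∈ 𝓞` with `3 = ϖ⁶θ`,
`θθ' = 1`, such that every reduction map `ρ : 𝓞 → 𝔽₃` has kernel contained in `ϖ𝓞`, and `x³ ≡ x (mod ϖ)` for every
`x ∈ 𝓞` (the residue field is `𝔽₃`; cycu-p4 g7 `NineIntegers.residueMap_eq_zero_iff`, cycu-p3 g6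
`three_eq_neg_pow_six_mul_thetaInv`). [folklore] -/
theorem exists_uniformizer : ∃ ϖ θ θ' : ONine, (3 : ONine) = ϖ ^ 6 * θ ∧ θ * θ' = 1 ∧
    (∀ (ρ : ONine →+* ZMod 3) (x : ONine), ρ x = 0 → ϖ ∣ x) ∧ ∀ x : ONine, ϖ ∣ x ^ 3 - x := by
  set ζ := zeta 9 ℚ_[3] KNine with hζdef
  refine ⟨⟨1 - ζ, one_sub_zeta_mem⟩, -⟨_, thetaInv_mem⟩, -⟨_, theta_mem⟩, ?_, ?_, ?_, ?_⟩
  · apply Subtype.ext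
    push_cast
    rw [three_eq_neg_pow_six_mul_thetaInv zeta_spec]
    ring
  · rw [neg_mul_neg]
    apply Subtype.ext
    push_cast
    rw [mul_comm]
    exact theta_mul_thetaInv zeta_spec
  · intro ρ x hx
    obtain ⟨y, hy, h⟩ := (residueMap_eq_zero_iff ρ x).mp hx
    exact ⟨⟨y, hy⟩, Subtype.ext (by push_cast; exact h)⟩
  · intro x
    obtain ⟨ρ⟩ := nonempty_residueMap
    have h0 : ρ (x ^ 3 - x) = 0 := by rw [map_sub, map_pow, ZMod.pow_card, sub_self]
    obtain ⟨y, hy, h⟩ := (residueMap_eq_zero_iff ρ _).mp h0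
    exact ⟨⟨y, hy⟩, Subtype.ext (by push_cast at h ⊢; exact h)⟩

end Uniformizer

/-! ## §4 `φ : [f] ↦ [f(z³)]` is well defined on the second-kind classes of a good model -/

/-- **`G³ ≡ G(X³,Y³) (mod ϖ)` coefficientwise** for every `G ∈ 𝓞⟦σ⟧`: along a reduction map `ρ : 𝓞 → 𝔽₃` with
`ker ρ ⊆ (ϖ)` the two sides agree, as `x ↦ x³` is the identity of `𝔽₃` (Mathlib `MvPowerSeries.map_frobenius_expand`,
`ZMod.frobenius_zmod`). [cite: BerthelotOgus1983, Thm. 2.4 (proof)] -/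
theorem dvd_mvCoeff_pow_three_sub_expand {σ : Type*} {ϖ : ONine} (ρ : ONine →+* ZMod 3)
    (hker : ∀ x : ONine, ρ x = 0 → ϖ ∣ x) (G : MvPowerSeries σ ONine) (e : σ →₀ ℕ) :
    ϖ ∣ MvPowerSeries.coeff e (G ^ 3 - MvPowerSeries.expand 3 (by norm_num) G) := by
  apply hker
  have hfrob := MvPowerSeries.map_frobenius_expand 3 (by norm_num) (f := G.map ρ)
  simp only [ZMod.frobenius_zmod, MvPowerSeries.map_id, RingHom.id_apply] at hfrob
  have h0 : (G ^ 3 - MvPowerSeries.expand 3 (by norm_num) G).map ρ = 0 := by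
    rw [map_sub, map_pow, MvPowerSeries.map_expand, hfrob, sub_self]
  rw [← MvPowerSeries.coeff_map, h0, MvPowerSeries.coeff_zero]

/-- `(expand q f)(Γ) = f(Γ^q)` over any commutative ring. [folklore] -/
theorem expand_subst_eq {S : Type*} [CommRing S] {τ : Type*} {Γ : MvPowerSeries τ S}
    (hΓ : MvPowerSeries.constantCoeff Γ = 0) (q : ℕ) (hq : q ≠ 0) (f : S⟦X⟧) :
    (expand q hq f).subst Γ = f.subst (Γ ^ q) := by
  have hs : HasSubst Γ := HasSubst.of_constantCoeff_zero hΓ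
  rw [expand_apply, subst_comp_subst_apply (PowerSeries.HasSubst.X_pow hq) hs, subst_pow hs, subst_X hs]

/-- `f(Γ(X^q)) = (f(Γ))(X^q)` over any commutative ring. [folklore] -/
theorem subst_expand_eq {S : Type*} [CommRing S] {τ : Type*} {Γ : MvPowerSeries τ S}
    (hΓ : MvPowerSeries.constantCoeff Γ = 0) (q : ℕ) (hq : q ≠ 0) (f : S⟦X⟧) :
    f.subst (MvPowerSeries.expand q hq Γ) = MvPowerSeries.expand q hq (f.subst Γ) := by
  have hs : HasSubst Γ := HasSubst.of_constantCoeff_zero hΓ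
  rw [PowerSeries.subst, PowerSeries.subst, MvPowerSeries.expand_subst _ _ hs.const]

/-- **`n·[zⁿ]f(z³)` keeps bounded denominators**: if `3ᵈ·n·[zⁿ]f ∈ 𝓞` for all `n` then
`3ᵈ·n·[zⁿ](f(z³)) ∈ 𝓞` for all `n` (`[z^{3k}]f(z³) = f_k` and `3k·f_k = 3·(k f_k)`). [folklore] -/
theorem isIntegral_natCast_mul_coeff_expand {f : KNine⟦X⟧} {d : ℕ}
    (hf : ∀ n : ℕ, IsIntegral ℤ_[3] ((3 : KNine) ^ d * ((n : KNine) * coeff n f))) (n : ℕ) :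
    IsIntegral ℤ_[3] ((3 : KNine) ^ d * ((n : KNine) * coeff n (expand 3 (by norm_num) f))) := by
  rw [coeff_expand]
  split_ifs with h
  · obtain ⟨k, rfl⟩ := h
    rw [Nat.mul_div_cancel_left k (by norm_num : 0 < 3), Nat.cast_mul,
      show (3 : KNine) ^ d * (((3 : ℕ) : KNine) * (k : KNine) * coeff k f) =
        ((3 : ℕ) : KNine) * ((3 : KNine) ^ d * ((k : KNine) * coeff k f)) by ring]
    have h3 : IsIntegral ℤ_[3] (((3 : ℕ) : KNine)) := by
      rw [show ((3 : ℕ) : KNine) = algebraMap ℤ_[3] KNine 3 by rw [Nat.cast_ofNat, map_ofNat]]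
      exact isIntegral_algebraMap
    exact h3.mul (hf k)
  · rw [mul_zero, mul_zero]; exact isIntegral_zero

/-- `3ᵏ` is integral. [folklore] -/
theorem isIntegral_three_pow (k : ℕ) : IsIntegral ℤ_[3] ((3 : KNine) ^ k) := by
  rw [show (3 : KNine) = algebraMap ℤ_[3] KNine 3 by rw [map_ofNat]]
  exact isIntegral_algebraMap.pow k

/-- **`φ[f] := [f(z³)]` IS WELL DEFINED ON KATZ'S MODULE OF A WEIERSTRASS EQUATION OVER `𝓞`** (bounded-denominator
version of [Ka81, Thm. 5.1.4] for the lifting `z ↦ z³` of the relative Frobenius, which is a homomorphism of the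
reduction modulo `ϖ = 1 − ζ₉` although `(ϖ)` carries no divided powers). Let `E/𝓞` be a Weierstrass equation,
`Ĝ` its formal group law read over `ℚ₃(ζ₉)`, and `f ∈ ℚ₃(ζ₉)⟦z⟧` with `3ᵈ·n·[zⁿ]f ∈ 𝓞` whose coboundary
`∂_Ĝ f = f(Ĝ) − f(X) − f(Y)` has `3^{d'}`-bounded denominators. Then the coboundary of `f(z³)` has
`3^{d+1+d'}`-bounded denominators: `∂_Ĝ(f(z³)) = [f(Ĝ³) − f(Ĝ(X³,Y³))] + (∂_Ĝ f)(X³,Y³)` with `Ĝ³ ≡ Ĝ(X³,Y³) (mod ϖ)`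
and the Key Lemma modulo `ϖ` (§2). [cite: Katz1981CrystallineDieudonne, §5 Thm 5.1.4]
[cite: BerthelotOgus1983, Thm. 2.4 (proof)] -/
theorem coboundary_expand_three {ϖ θ θ' : ONine} (h3 : (3 : ONine) = ϖ ^ 6 * θ) (hθ : θ * θ' = 1)
    (ρ : ONine →+* ZMod 3) (hker : ∀ x : ONine, ρ x = 0 → ϖ ∣ x) (E : WeierstrassCurve ONine)
    {f : KNine⟦X⟧} {d : ℕ} (hf : ∀ n : ℕ, IsIntegral ℤ_[3] ((3 : KNine) ^ d * ((n : KNine) * coeff n f)))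
    {d' : ℕ} (hcob : ∀ e, IsIntegral ℤ_[3] ((3 : KNine) ^ d' * MvPowerSeries.coeff e
      (f.subst (E.map (algebraMap ONine KNine)).formalGroupLaw - f.subst (MvPowerSeries.X 0) -
        f.subst (MvPowerSeries.X 1))))
    (e : Fin 2 →₀ ℕ) :
    IsIntegral ℤ_[3] ((3 : KNine) ^ (d + 1 + d') * MvPowerSeries.coeff e
      ((expand 3 (by norm_num) f).subst (E.map (algebraMap ONine KNine)).formalGroupLaw -
        (expand 3 (by norm_num) f).subst (MvPowerSeries.X 0) - (expand 3 (by norm_num) f).subst (MvPowerSeries.X 1))) := by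
  set ι := algebraMap ONine KNine with hι
  set GO := E.formalGroupLaw with hGO
  have hGK : (E.map ι).formalGroupLaw = GO.map ι := by rw [hGO, WeierstrassCurve.map_formalGroupLaw]
  have hG0 : MvPowerSeries.constantCoeff GO = 0 := E.constantCoeff_formalGroupLaw
  have hGK0 : MvPowerSeries.constantCoeff (GO.map ι) = 0 := by rw [MvPowerSeries.constantCoeff_map, hG0, map_zero]
  have hX0 : ∀ i : Fin 2, MvPowerSeries.constantCoeff (MvPowerSeries.X i : MvPowerSeries (Fin 2) KNine) = 0 :=
    fun i ↦ MvPowerSeries.constantCoeff_X i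
  -- (1) `GO³ ≡ GO(X³,Y³) (mod ϖ)`
  have hUV : MvPowerSeries.C ϖ ∣ GO ^ 3 - MvPowerSeries.expand 3 (by norm_num) GO := by
    choose c hc using dvd_mvCoeff_pow_three_sub_expand ρ hker GO
    refine ⟨fun e ↦ c e, MvPowerSeries.ext fun e ↦ ?_⟩
    rw [MvPowerSeries.coeff_C_mul]
    exact hc e
  -- (2) Key Lemma modulo `ϖ`
  have hkey := isIntegral_three_pow_mul_mvCoeff_subst_sub_subst h3 hθ hf
    (show MvPowerSeries.constantCoeff (GO ^ 3) = 0 by rw [map_pow, hG0, zero_pow (by norm_num)])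
    (show MvPowerSeries.constantCoeff (MvPowerSeries.expand 3 (by norm_num) GO) = 0 by
      rw [MvPowerSeries.constantCoeff_expand, hG0]) hUV e
  -- (3) decomposition of the coboundary of `f(z³)`
  have hdec : (expand 3 (by norm_num) f).subst (E.map ι).formalGroupLaw -
        (expand 3 (by norm_num) f).subst (MvPowerSeries.X 0) - (expand 3 (by norm_num) f).subst (MvPowerSeries.X 1) =
      (f.subst ((GO ^ 3).map ι) - f.subst ((MvPowerSeries.expand 3 (by norm_num) GO).map ι)) +
        MvPowerSeries.expand 3 (by norm_num)
          (f.subst (E.map ι).formalGroupLaw - f.subst (MvPowerSeries.X 0) - f.subst (MvPowerSeries.X 1)) := by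
    rw [hGK, expand_subst_eq hGK0, expand_subst_eq (hX0 0), expand_subst_eq (hX0 1), map_sub, map_sub,
      ← subst_expand_eq hGK0, ← subst_expand_eq (hX0 0), ← subst_expand_eq (hX0 1),
      MvPowerSeries.expand_X, MvPowerSeries.expand_X, map_pow, MvPowerSeries.map_expand]
    ring
  rw [hdec, map_add, mul_add]
  refine IsIntegral.add ?_ ?_
  · rw [pow_add, mul_comm ((3 : KNine) ^ (d + 1)), mul_assoc]
    exact (isIntegral_three_pow d').mul hkey
  · by_cases hd : ∀ i, 3 ∣ e i
    · choose m hm using hd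
      have em : e = 3 • (Finsupp.equivFunOnFinite.symm m : Fin 2 →₀ ℕ) := by
        ext i; simp [hm i]
      rw [em, MvPowerSeries.coeff_expand_smul, pow_add, mul_assoc]
      exact (isIntegral_three_pow (d + 1)).mul (hcob _)
    · obtain ⟨i, hi⟩ := not_forall.mp hd
      rw [MvPowerSeries.coeff_expand_of_not_dvd 3 (by norm_num) _ hi, mul_zero]
      exact isIntegral_zero

end Summit.BirchSwinnertonDyer.BirchSwinnertonDyer.Theorems.KatzFrobenius
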